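import Summits.ValiantsHypothesis.ValiantsHypothesis.Theorems.BarrierLeverAnchoredDoorHitsLowerPairsStarRigid

/-!
# Route BarrierLever — support item `AnchoredDoorHitsLowerPairs` (stmt-ValiantsHypothesis-22510), line `anchored_peeling`:
# TN-STAR REDUCES TO VERTEX–FACE-RIGID FAMILIES (val-np-p1 g32)

The theory target `Stmt.conjStarTN` (…StarDoor: the star-forest matrix is totally nonsingular — NO lower-set hypothesis) admits the same by-name
narrowing as the door slot (…StarRigid), because the FACE PIVOT (…StarFacePivot) needs no lower-set hypothesis either: for injective families
`u`, `w` of equal size with a balanced row vertex `b₀` against a column vertex set `T` (as many rows contain `b₀` as columns contain `T`, and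
some row contains `b₀`), the link families `((u i) − b₀)`, `(w (σ j)) ∖ T` and the deletion families are again injective and of strictly
smaller TOTAL SIZE `Σ |u i| + Σ |w j|`. Strong induction on the total size gives

* `conjStarTN_of_conjStarTNRigid : Stmt.conjStarTNRigid → Stmt.conjStarTN`, with the node text
* `Stmt.conjStarTNRigid` := TN-STAR restricted to vertex–face-rigid (`StarDoor.IsFaceRigid`) injective families, and hence
* `anchoredDoorHitsLowerPairs_of_conjStarTNRigid` (via …StarArrow's `anchoredDoorHitsLowerPairs_of_conjStarTN`).

This file does NOT prove `Stmt.conjStarTN`; nothing here bears on crux 14610 or on `VP ≠ VNP`.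
-/

set_option linter.dupNamespace false

namespace Summit.ValiantsHypothesis.ValiantsHypothesis.Theorems.BarrierLever.AnchoredPeeling

open Finset

noncomputable section

namespace StarDoor

variable {h : ℕ}

section StepTN

variable {r : ℕ} (u w : Fin r → Finset (Fin h))

/-- The total size of a pair of families: the induction measure for the TN reduction. -/
def totalSize {r : ℕ} (u w : Fin r → Finset (Fin h)) : ℕ := (∑ i, (u i).card) + ∑ j, (w j).card

/-- **The inductive step for TN (row side).** If every injective pair of families of smaller total size has a nonsingular star-forest block,
then so does an injective pair admitting a balanced row vertex `b₀` (lying in some row) against a column vertex set `T`. -/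
theorem starDet_ne_zero_of_balanced_row_TN
    (IH : ∀ (m : ℕ) (u' w' : Fin m → Finset (Fin h)), totalSize u' w' < totalSize u w →
      Function.Injective u' → Function.Injective w' →
      ∃ g d : Fin h → Fin h → ℂ, (Matrix.of fun i j : Fin m => starEntry g d (u' i) (w' j)).det ≠ 0)
    (hu : Function.Injective u) (hw : Function.Injective w)
    (b₀ : Fin h) (T : Finset (Fin h)) (hb₀ : ∃ i, b₀ ∈ u i)
    (hcard : (Finset.univ.filter fun i => b₀ ∈ u i).card = (Finset.univ.filter fun j => T ⊆ w j).card) :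
    ∃ g d : Fin h → Fin h → ℂ, (Matrix.of fun i j : Fin r => starEntry g d (u i) (w j)).det ≠ 0 := by
  classical
  obtain ⟨σ, hσ⟩ := exists_matching_perm u w b₀ T hcard
  obtain ⟨i₁, hi₁⟩ := hb₀
  set k := Fintype.card {i : Fin r // b₀ ∈ u i} with hk
  set m₀ := Fintype.card {i : Fin r // ¬ b₀ ∈ u i} with hm₀
  let eL : {i : Fin r // b₀ ∈ u i} ≃ Fin k := Fintype.equivFin _
  let eD : {i : Fin r // ¬ b₀ ∈ u i} ≃ Fin m₀ := Fintype.equivFin _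
  -- total size, split along the predicate and reindexed by σ on the column side
  have hsplit_u : (∑ i, (u i).card) = (∑ i : {i : Fin r // b₀ ∈ u i}, (u i).card) + ∑ i : {i : Fin r // ¬ b₀ ∈ u i}, (u i).card :=
    (Fintype.sum_subtype_add_sum_subtype (fun i : Fin r => b₀ ∈ u i) (fun i => (u i).card)).symm
  have hsplit_w : (∑ j, (w j).card) = (∑ i : {i : Fin r // b₀ ∈ u i}, (w (σ i)).card) + ∑ i : {i : Fin r // ¬ b₀ ∈ u i}, (w (σ i)).card := by
    rw [← Equiv.sum_comp σ (fun j => (w j).card)]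
    exact (Fintype.sum_subtype_add_sum_subtype (fun i : Fin r => b₀ ∈ u i) (fun i => (w (σ i)).card)).symm
  have hpos : 1 ≤ ∑ i : {i : Fin r // b₀ ∈ u i}, (u i).card := by
    have h1 : 1 ≤ (u i₁).card := Finset.card_pos.mpr ⟨b₀, hi₁⟩
    have h2 : (fun i : {i : Fin r // b₀ ∈ u i} => (u i).card) ⟨i₁, hi₁⟩ ≤ ∑ i : {i : Fin r // b₀ ∈ u i}, (u i).card :=
      Finset.single_le_sum (f := fun i : {i : Fin r // b₀ ∈ u i} => (u i).card) (fun _ _ => Nat.zero_le _) (Finset.mem_univ _)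
    exact h1.trans h2
  -- the LINK pair
  let uL : Fin k → Finset (Fin h) := fun m => (u (eL.symm m)).erase b₀
  let wL : Fin k → Finset (Fin h) := fun m => (w (σ (eL.symm m))) \ T
  have huL : Function.Injective uL := by
    intro m m' hmm'
    have h1 : u (eL.symm m) = u (eL.symm m') := by
      have := congrArg (insert b₀) hmm'
      simp only [uL, Finset.insert_erase (eL.symm m).2, Finset.insert_erase (eL.symm m').2] at this
      exact this
    exact eL.symm.injective (Subtype.ext (hu h1))
  have hwL : Function.Injective wL := by
    intro m m' hmm'
    have hT : T ⊆ w (σ (eL.symm m)) := (hσ _).mpr (eL.symm m).2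
    have hT' : T ⊆ w (σ (eL.symm m')) := (hσ _).mpr (eL.symm m').2
    have h1 : w (σ (eL.symm m)) = w (σ (eL.symm m')) := by
      have := congrArg (· ∪ T) hmm'
      simp only [wL, Finset.sdiff_union_of_subset hT, Finset.sdiff_union_of_subset hT'] at this
      exact this
    exact eL.symm.injective (Subtype.ext (σ.injective (hw h1)))
  have hsizeL : totalSize uL wL < totalSize u w := by
    have hL1 : (∑ m, (uL m).card) + k = ∑ i : {i : Fin r // b₀ ∈ u i}, (u i).card := by
      have : (∑ m, (uL m).card) = ∑ i : {i : Fin r // b₀ ∈ u i}, ((u i).card - 1) := by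
        rw [← Equiv.sum_comp eL.symm (fun i : {i : Fin r // b₀ ∈ u i} => (u i).card - 1)]
        refine Finset.sum_congr rfl fun m _ => ?_
        simp only [uL, Finset.card_erase_of_mem (eL.symm m).2]
      have h2 : k = ∑ _i : {i : Fin r // b₀ ∈ u i}, 1 := by simp [hk]
      rw [this, h2, ← Finset.sum_add_distrib]
      refine Finset.sum_congr rfl fun i _ => ?_
      exact Nat.sub_add_cancel (Finset.card_pos.mpr ⟨b₀, i.2⟩)
    have hL2 : (∑ m, (wL m).card) ≤ ∑ i : {i : Fin r // b₀ ∈ u i}, (w (σ i)).card := by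
      rw [← Equiv.sum_comp eL.symm (fun i : {i : Fin r // b₀ ∈ u i} => (w (σ i)).card)]
      refine Finset.sum_le_sum fun m _ => ?_
      simp only [wL]
      exact Finset.card_le_card Finset.sdiff_subset
    have hk1 : 1 ≤ k := by rw [hk]; exact Fintype.card_pos_iff.mpr ⟨⟨i₁, hi₁⟩⟩
    simp only [totalSize] at *
    rw [hsplit_u, hsplit_w]
    omega
  obtain ⟨g₁, d₁, hdet₁⟩ := IH k uL wL hsizeL huL hwL
  have Hlk : ∃ g d : Fin h → Fin h → ℂ,
      (Matrix.of fun i j : {i : Fin r // b₀ ∈ u i} => starEntry g d ((u i).erase b₀) ((w (σ j)) \ T)).det ≠ 0 := by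
    refine ⟨g₁, d₁, ?_⟩
    have hmat : (Matrix.of fun i j : {i : Fin r // b₀ ∈ u i} => starEntry g₁ d₁ ((u i).erase b₀) ((w (σ j)) \ T))
        = Matrix.reindex eL.symm eL.symm (Matrix.of fun m m' : Fin k => starEntry g₁ d₁ (uL m) (wL m')) := by
      ext i j
      simp only [Matrix.reindex_apply, Matrix.submatrix_apply, Matrix.of_apply, Equiv.symm_symm, uL, wL,
        Equiv.symm_apply_apply]
    rw [hmat, Matrix.det_reindex_self]
    exact hdet₁
  -- the DELETION pair
  let uD : Fin m₀ → Finset (Fin h) := fun m => u (eD.symm m)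
  let wD : Fin m₀ → Finset (Fin h) := fun m => w (σ (eD.symm m))
  have huD : Function.Injective uD := fun m m' hmm' => eD.symm.injective (Subtype.ext (hu hmm'))
  have hwD : Function.Injective wD := fun m m' hmm' => eD.symm.injective (Subtype.ext (σ.injective (hw hmm')))
  have hsizeD : totalSize uD wD < totalSize u w := by
    have hD1 : (∑ m, (uD m).card) = ∑ i : {i : Fin r // ¬ b₀ ∈ u i}, (u i).card := by
      rw [← Equiv.sum_comp eD.symm (fun i : {i : Fin r // ¬ b₀ ∈ u i} => (u i).card)]
    have hD2 : (∑ m, (wD m).card) = ∑ i : {i : Fin r // ¬ b₀ ∈ u i}, (w (σ i)).card := by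
      rw [← Equiv.sum_comp eD.symm (fun i : {i : Fin r // ¬ b₀ ∈ u i} => (w (σ i)).card)]
    simp only [totalSize] at *
    rw [hD1, hD2, hsplit_u, hsplit_w]
    omega
  obtain ⟨g₂, d₂, hdet₂⟩ := IH m₀ uD wD hsizeD huD hwD
  have Hdl : ∃ g d : Fin h → Fin h → ℂ,
      (Matrix.of fun i j : {i : Fin r // b₀ ∉ u i} => starEntry g d (u i) (w (σ j))).det ≠ 0 := by
    refine ⟨g₂, d₂, ?_⟩
    have hmat : (Matrix.of fun i j : {i : Fin r // b₀ ∉ u i} => starEntry g₂ d₂ (u i) (w (σ j)))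
        = Matrix.reindex eD.symm eD.symm (Matrix.of fun m m' : Fin m₀ => starEntry g₂ d₂ (uD m) (wD m')) := by
      ext i j
      simp only [Matrix.reindex_apply, Matrix.submatrix_apply, Matrix.of_apply, Equiv.symm_symm, uD, wD,
        Equiv.symm_apply_apply]
    rw [hmat, Matrix.det_reindex_self]
    exact hdet₂
  exact starDet_ne_zero_of_facePivot u w b₀ T σ hσ Hlk Hdl

end StepTN

end StarDoor

/-- **NODE TEXT (offered, D-0145): TN-STAR ON VERTEX–FACE-RIGID FAMILIES.** For all `h`, `r` and every pair of injective families `u`, `w` (no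
lower-set hypothesis) that is vertex–face rigid (`StarDoor.IsFaceRigid`), some complex weights make the star-forest block nonsingular. -/
def Stmt.conjStarTNRigid : Prop :=
  ∀ (h r : ℕ) (u w : Fin r → Finset (Fin h)), Function.Injective u → Function.Injective w → StarDoor.IsFaceRigid u w →
    ∃ g d : Fin h → Fin h → ℂ, (Matrix.of fun i j : Fin r => StarDoor.starEntry g d (u i) (w j)).det ≠ 0

/-- **TN-STAR ⟸ TN-STAR ON RIGID FAMILIES** (strong induction on the total size, peeling balanced vertex–face pivots on either side). -/
theorem conjStarTN_of_conjStarTNRigid (H : Stmt.conjStarTNRigid) : Stmt.conjStarTN := by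
  classical
  intro h
  -- strong induction on the total size
  suffices key : ∀ (N r : ℕ) (u w : Fin r → Finset (Fin h)), StarDoor.totalSize u w ≤ N →
      Function.Injective u → Function.Injective w →
      ∃ g d : Fin h → Fin h → ℂ, (Matrix.of fun i j : Fin r => StarDoor.starEntry g d (u i) (w j)).det ≠ 0 by
    intro r u w hu hw
    exact key _ r u w le_rfl hu hw
  intro N
  induction N with
  | zero =>
    intro r u w hN hu hw
    -- total size 0: every face empty, so by injectivity r ≤ 1; the empty block or the 1×1 block [1]
    have hu0 : ∀ i, u i = ∅ := by
      intro i
      have : (u i).card = 0 := by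
        have h1 : (u i).card ≤ ∑ i, (u i).card :=
          Finset.single_le_sum (f := fun i => (u i).card) (fun _ _ => Nat.zero_le _) (Finset.mem_univ i)
        simp only [StarDoor.totalSize] at hN; omega
      exact Finset.card_eq_zero.mp this
    have hw0 : ∀ j, w j = ∅ := by
      intro j
      have : (w j).card = 0 := by
        have h1 : (w j).card ≤ ∑ j, (w j).card :=
          Finset.single_le_sum (f := fun j => (w j).card) (fun _ _ => Nat.zero_le _) (Finset.mem_univ j)
        simp only [StarDoor.totalSize] at hN; omega
      exact Finset.card_eq_zero.mp this
    have hsub : Subsingleton (Fin r) := ⟨fun i j => hu (by rw [hu0, hu0])⟩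
    refine ⟨fun _ _ => 0, fun _ _ => 0, ?_⟩
    have hM : (Matrix.of fun i j : Fin r => StarDoor.starEntry (fun _ _ => (0 : ℂ)) (fun _ _ => 0) (u i) (w j)) = 1 := by
      ext i j
      have hij : i = j := Subsingleton.elim i j
      subst hij
      simp only [Matrix.of_apply, Matrix.one_apply_eq, hu0, hw0, StarDoor.starEntry_empty_empty]
    rw [hM, Matrix.det_one]
    exact one_ne_zero
  | succ N ih =>
    intro r u w hN hu hw
    by_cases hle : StarDoor.totalSize u w ≤ N
    · exact ih r u w hle hu hw
    have IH : ∀ (m : ℕ) (u' w' : Fin m → Finset (Fin h)), StarDoor.totalSize u' w' < StarDoor.totalSize u w →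
        Function.Injective u' → Function.Injective w' →
        ∃ g d : Fin h → Fin h → ℂ, (Matrix.of fun i j : Fin m => StarDoor.starEntry g d (u' i) (w' j)).det ≠ 0 :=
      fun m u' w' hlt hu' hw' => ih m u' w' (by omega) hu' hw'
    by_cases h1 : ∃ (b₀ : Fin h) (T : Finset (Fin h)), (∃ i, b₀ ∈ u i) ∧
        (Finset.univ.filter fun i => b₀ ∈ u i).card = (Finset.univ.filter fun j => T ⊆ w j).card
    · obtain ⟨b₀, T, hb₀, hcard⟩ := h1
      exact StarDoor.starDet_ne_zero_of_balanced_row_TN u w IH hu hw b₀ T hb₀ hcard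
    by_cases h2 : ∃ (e₀ : Fin h) (A₀ : Finset (Fin h)), (∃ j, e₀ ∈ w j) ∧
        (Finset.univ.filter fun j => e₀ ∈ w j).card = (Finset.univ.filter fun i => A₀ ⊆ u i).card
    · obtain ⟨e₀, A₀, he₀, hcard⟩ := h2
      have IH' : ∀ (m : ℕ) (u' w' : Fin m → Finset (Fin h)), StarDoor.totalSize u' w' < StarDoor.totalSize w u →
          Function.Injective u' → Function.Injective w' →
          ∃ g d : Fin h → Fin h → ℂ, (Matrix.of fun i j : Fin m => StarDoor.starEntry g d (u' i) (w' j)).det ≠ 0 := by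
        intro m u' w' hlt hu' hw'
        have hsymm : StarDoor.totalSize w u = StarDoor.totalSize u w := by
          simp only [StarDoor.totalSize]; omega
        exact IH m u' w' (by rw [← hsymm]; exact hlt) hu' hw'
      obtain ⟨g', d', hdet⟩ := StarDoor.starDet_ne_zero_of_balanced_row_TN w u IH' hw hu e₀ A₀ he₀ hcard
      refine ⟨fun b e => d' e b, fun b e => g' e b, ?_⟩
      have hmat : (Matrix.of fun i j : Fin r => StarDoor.starEntry (fun b e => d' e b) (fun b e => g' e b) (u i) (w j))
          = (Matrix.of fun i j : Fin r => StarDoor.starEntry g' d' (w i) (u j)).transpose := by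
        ext i j
        simp only [Matrix.of_apply, Matrix.transpose_apply]
        rw [StarDoor.starEntry_swap]
      rw [hmat, Matrix.det_transpose]
      exact hdet
    · push Not at h1 h2
      exact H h r u w hu hw ⟨fun b₀ T hb => h1 b₀ T hb, fun e₀ A₀ he => h2 e₀ A₀ he⟩

/-- **COMPOSITION BY NAME: `Stmt.conjStarTNRigid → AnchoredDoorHitsLowerPairs`.** -/
theorem anchoredDoorHitsLowerPairs_of_conjStarTNRigid (H : Stmt.conjStarTNRigid) :
    Summit.ValiantsHypothesis.ValiantsHypothesis.Theses.BarrierLever.AnchoredDoorHitsLowerPairs :=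
  anchoredDoorHitsLowerPairs_of_conjStarTN (conjStarTN_of_conjStarTNRigid H)

end

end Summit.ValiantsHypothesis.ValiantsHypothesis.Theorems.BarrierLever.AnchoredPeeling
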